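import Mathlib
import Literature.Analysis.FluidPDE.IsometryInvariance
import Literature.Analysis.FluidPDE.ClassicalSolutionGalilean
import Literature.Analysis.FluidPDE.AxisymmetricVorticityTransport
import Literature.Analysis.FluidPDE.KNSSAxisymmetricNoSwirlHolds
import Summits.NavierStokesRegularity.NavierStokesRegularity.Theorems.ThreadingFluxCentreJetDefs
import HarnessLib

/-!
# Crux `PoloidalLiouville` (stmt-NavierStokesRegularity-1222, wall W1), crux idea «steady-centre-sieve» (ns-idea-15 g5,
# `Cruxes/PoloidalLiouville/CentreJetSketch.lean`): the REDUCTIONS R2 `NoTypeNCentreOfRigidity` and R2* `SteadyStratumOfRigidity`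

Support file (Theorems-side; seat ns-wall-eng-7 g5, cell ns-wall-extremal, W1 adjunct; `--supports
stmt-NavierStokesRegularity-1222 --as helper`).  The two M⁺ reductions of the card as kernel theorems, bodies VERBATIM (the sketch's
component Props F1 `SteadyNSAnalytic`, F2 `SteadyNSGradientBounds`, G1 `SteadyClassicalIsMild`, C1 `SteadyLocalRigidityN` / C1*
`SteadyLocalRigidity`, R1 `NoTypeNCentre`, W1ˢ `SteadyUnthreadedLiouville` written out; `IsSteadyNSOn`, `IsUnthreadedAbout` and R3
`IrrotationalSteadyLiouville` by name from the Theorems-side twin `ThreadingFluxCentreJetDefs.lean`):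

* `CentreJet.noTypeNCentreOfRigidity : F1 → F2 → G1 → C1 → R1` (sketch R2 `NoTypeNCentreOfRigidity`);
* `CentreJet.steadyStratumOfRigidity : F1 → F2 → G1 → C1* → R3 → W1ˢ` (sketch R2* `SteadyStratumOfRigidity`).

These are IMPLICATIONS between the card's typed statements — F1/F2/G1 are literature-grade facts NOT discharged here, C1/C1* are
CONJECTURES; what the kernel certifies is the card's claim that C1 (resp. C1*) closes the type-N case (resp. the whole) of W1's steady
stratum GIVEN F1, F2, G1.  The engine is `CentreJet.eq_const_of_local_symmetry`: a bounded classical steady flow on `ℝ³` with analytic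
velocity that is, in some Euclidean frame at `x₀`, rotation-invariant and swirl-free on a ball is CONSTANT (given F2, G1).

Proof (the sketch's «inside the M⁺ proof» items): (i) EUCLIDEAN COVARIANCE — if `(V, p)` is a classical steady solution on `ℝ³` and
`g` a linear isometry, `W(y) = g⁻¹ V(x₀ + g y)`, `q(y) = p(x₀ + g y)` is again one (`isSteadyNSOn_conj`; tree `IsometryInvariance`:
`convect_conj_linearIsometryEquiv`, `divergence_conj_linearIsometryEquiv`, `gradient_comp_linearIsometryEquiv_symm`,
`laplacian_conj_linearIsometryEquiv`, plus the translation rules `fderiv_comp_add_left`, `laplacian_comp_add_right`);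
(ii) ANALYTIC CONTINUATION — by F1 `V`, hence `W`, is real-analytic on `ℝ³`, so the identities `W(R_θ y) = R_θ W(y)` and
`swirl W (y) = 0`, given on a ball about `0`, hold on `ℝ³` (`AnalyticOnNhd.eqOn_of_preconnected_of_eventuallyEq`): `W` is
axisymmetric without swirl (`isAxisymmetric_hasNoSwirl_of_ball`); (iii) KNSS — by F2 and G1 the constant-in-time field `W` is a bounded
ancient mild solution, so KNSS 2009 Thm 5.2 (tree theorem `Literature.Analysis.FluidPDE.knss_axisymmetric_no_swirl'_holds`) makes it
a.e., hence (continuity) everywhere, constant; so is `V`.  For R2 a constant `V` has `ΔV = 0`; for R2* the irrotational case is R3.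

HONEST LABEL: conditional reductions about typed objects of one crux idea; F1/F2/G1 not discharged, C1/C1* open, `PoloidalLiouville`
(1222) and NS regularity OPEN and untouched; information-grade (movement 0).
[cite: KochNadirashviliSereginSverak2009, Thm 5.2 (arXiv pp. 9–10)] [cite: MajdaBertozziCUP2002, §1.2 Prop. 1.1 (iii)]
-/

-- the summit and its single problem share the name (D-0017 nested layout)
set_option linter.dupNamespace false

noncomputable section

open Set Function Filter MeasureTheory
open scoped RealInnerProductSpace Topology
open Literature.Analysis.FluidPDE

namespace Summit.NavierStokesRegularity.NavierStokesRegularity.Theorems.PoloidalLiouville.CentreJet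

/-! ### (i) Euclidean covariance of classical steady Navier–Stokes on `ℝ³` -/

/-- Translation covariance of the divergence: `div (V(x₀ + ·))(z) = div V (x₀ + z)`. -/
theorem divergence_comp_const_add (V : E3 → E3) (x₀ z : E3) :
    VectorCalculus.divergence (fun x => V (x₀ + x)) z = VectorCalculus.divergence V (x₀ + z) := by
  simp only [VectorCalculus.divergence, fderiv_comp_add_left]

/-- Translation covariance of the gradient: `∇(p(x₀ + ·))(z) = ∇p (x₀ + z)`. -/
theorem gradient_comp_const_add (p : E3 → ℝ) (x₀ z : E3) :
    gradient (fun x => p (x₀ + x)) z = gradient p (x₀ + z) := by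
  simp only [gradient, fderiv_comp_add_left]

/-- Translation covariance of the Laplacian: `Δ(V(x₀ + ·))(z) = ΔV (x₀ + z)` (tree `laplacian_comp_add_right`). -/
theorem laplacian_comp_const_add {F : Type*} [NormedAddCommGroup F] [NormedSpace ℝ F] (V : E3 → F) (x₀ z : E3) :
    Laplacian.laplacian (fun x => V (x₀ + x)) z = Laplacian.laplacian V (x₀ + z) := by
  have h : (fun x => V (x₀ + x)) = fun x => V (x + x₀) := by
    funext x; rw [add_comm]
  rw [h, laplacian_comp_add_right, add_comm]

section Covariance

variable (V : E3 → E3) (p : E3 → ℝ) (x₀ : E3) (g : E3 ≃ₗᵢ[ℝ] E3)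

/-- `div (g⁻¹ V(x₀ + g ·))(y) = div V (x₀ + g y)`. -/
theorem divergence_conjFrame (y : E3) :
    VectorCalculus.divergence (fun y => g.symm (V (x₀ + g y))) y = VectorCalculus.divergence V (x₀ + g y) := by
  have h := divergence_conj_linearIsometryEquiv g.symm (fun x => V (x₀ + x)) y
  simp only [LinearIsometryEquiv.symm_symm] at h
  rw [h, divergence_comp_const_add]

/-- `D(g⁻¹ V(x₀ + g ·))(y) [g⁻¹ V(x₀ + g y)] = g⁻¹ (DV (x₀ + g y) [V (x₀ + g y)])` (the convective term is frame covariant). -/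
theorem convect_conjFrame (y : E3) :
    fderiv ℝ (fun y => g.symm (V (x₀ + g y))) y (g.symm (V (x₀ + g y))) =
      g.symm (fderiv ℝ V (x₀ + g y) (V (x₀ + g y))) := by
  have h := convect_conj_linearIsometryEquiv g.symm (fun x => V (x₀ + x)) (fun x => V (x₀ + x)) y
  simp only [convect_apply, LinearIsometryEquiv.symm_symm, fderiv_comp_add_left] at h
  exact h

/-- `∇(p(x₀ + g ·))(y) = g⁻¹ (∇p (x₀ + g y))`. -/
theorem gradient_conjFrame (y : E3) :
    gradient (fun y => p (x₀ + g y)) y = g.symm (gradient p (x₀ + g y)) := by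
  have h := gradient_comp_linearIsometryEquiv_symm g.symm (fun x => p (x₀ + x)) y
  simp only [LinearIsometryEquiv.symm_symm] at h
  rw [h, gradient_comp_const_add]

/-- `Δ(g⁻¹ V(x₀ + g ·))(y) = g⁻¹ (ΔV (x₀ + g y))`. -/
theorem laplacian_conjFrame (y : E3) :
    Laplacian.laplacian (fun y => g.symm (V (x₀ + g y))) y = g.symm (Laplacian.laplacian V (x₀ + g y)) := by
  have h := laplacian_conj_linearIsometryEquiv g.symm (fun x => V (x₀ + x)) y
  simp only [LinearIsometryEquiv.symm_symm] at h
  rw [h, laplacian_comp_const_add]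

/-- **Euclidean covariance.**  If `(V, p)` is a classical steady Navier–Stokes flow on `ℝ³` and `g` a linear isometry of `ℝ³`, then
`W(y) = g⁻¹ V(x₀ + g y)`, `q(y) = p(x₀ + g y)` is a classical steady Navier–Stokes flow on `ℝ³`. -/
theorem isSteadyNSOn_conjFrame {V p} (hNS : IsSteadyNSOn univ V p) (x₀ : E3) (g : E3 ≃ₗᵢ[ℝ] E3) :
    IsSteadyNSOn univ (fun y => g.symm (V (x₀ + g y))) (fun y => p (x₀ + g y)) := by
  obtain ⟨hV, hp, hdiv, heq⟩ := hNS
  have hVc : ContDiff ℝ 3 V := contDiffOn_univ.1 hV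
  have hpc : ContDiff ℝ 1 p := contDiffOn_univ.1 hp
  have haff : ContDiff ℝ 3 (fun y : E3 => x₀ + g y) :=
    contDiff_const.add g.toContinuousLinearEquiv.toContinuousLinearMap.contDiff
  have haff1 : ContDiff ℝ 1 (fun y : E3 => x₀ + g y) :=
    contDiff_const.add g.toContinuousLinearEquiv.toContinuousLinearMap.contDiff
  refine ⟨?_, ?_, fun y _ => ?_, fun y _ => ?_⟩
  · exact (g.symm.toContinuousLinearEquiv.toContinuousLinearMap.contDiff.comp (hVc.comp haff)).contDiffOn
  · exact (hpc.comp haff1).contDiffOn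
  · rw [divergence_conjFrame, hdiv _ (mem_univ _)]
  · rw [convect_conjFrame, gradient_conjFrame, laplacian_conjFrame, ← map_add, heq _ (mem_univ _)]

end Covariance

/-- Restricting a classical steady flow on `ℝ³` to a subset. -/
theorem IsSteadyNSOn.of_univ {V : E3 → E3} {p : E3 → ℝ} (h : IsSteadyNSOn univ V p) (U : Set E3) : IsSteadyNSOn U V p :=
  ⟨h.1.mono (subset_univ _), h.2.1.mono (subset_univ _), fun x _ => h.2.2.1 x (mem_univ _), fun x _ => h.2.2.2 x (mem_univ _)⟩

/-! ### (ii) Analytic continuation of the symmetry identities from a ball to `ℝ³` -/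

/-- If a real-analytic field `W` on `ℝ³` is rotation-invariant and swirl-free on a ball about the origin, it is axisymmetric without
swirl on all of `ℝ³` (identity principle, `AnalyticOnNhd.eqOn_of_preconnected_of_eventuallyEq`). -/
theorem isAxisymmetric_hasNoSwirl_of_ball {W : E3 → E3} (hW : AnalyticOnNhd ℝ W univ) {ρ : ℝ} (hρ : 0 < ρ)
    (hrot : ∀ θ : ℝ, ∀ y : E3, ‖y‖ < ρ → W (rotZ θ y) = rotZ θ (W y))
    (hsw : ∀ y : E3, ‖y‖ < ρ → swirl W y = 0) : IsAxisymmetric W ∧ HasNoSwirl W := by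
  have hball : Metric.ball (0 : E3) ρ ∈ 𝓝 (0 : E3) := Metric.ball_mem_nhds 0 hρ
  refine ⟨fun θ y => ?_, fun y => ?_⟩
  · have h1 : AnalyticOnNhd ℝ (fun y => W (rotZ θ y)) univ :=
      hW.comp ((rotZL θ).analyticOnNhd univ) (mapsTo_univ _ _)
    have h2 : AnalyticOnNhd ℝ (fun y => rotZ θ (W y)) univ := (rotZL θ).comp_analyticOnNhd hW
    have h12 : (fun y => W (rotZ θ y)) =ᶠ[𝓝 (0 : E3)] fun y => rotZ θ (W y) := by
      filter_upwards [hball] with y hy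
      exact hrot θ y (mem_ball_zero_iff.1 hy)
    exact h1.eqOn_of_preconnected_of_eventuallyEq h2 isPreconnected_univ (mem_univ 0) h12 (mem_univ y)
  · have hc0 : AnalyticOnNhd ℝ (fun y : E3 => y 0) univ := (PiLp.proj (𝕜 := ℝ) 2 (fun _ : Fin 3 => ℝ) 0).analyticOnNhd univ
    have hc1 : AnalyticOnNhd ℝ (fun y : E3 => y 1) univ := (PiLp.proj (𝕜 := ℝ) 2 (fun _ : Fin 3 => ℝ) 1).analyticOnNhd univ
    have hW0 : AnalyticOnNhd ℝ (fun y : E3 => W y 0) univ := (PiLp.proj (𝕜 := ℝ) 2 (fun _ : Fin 3 => ℝ) 0).comp_analyticOnNhd hW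
    have hW1 : AnalyticOnNhd ℝ (fun y : E3 => W y 1) univ := (PiLp.proj (𝕜 := ℝ) 2 (fun _ : Fin 3 => ℝ) 1).comp_analyticOnNhd hW
    have h1 : AnalyticOnNhd ℝ (swirl W) univ := by
      have : swirl W = fun y => y 0 * W y 1 - y 1 * W y 0 := rfl
      rw [this]
      exact (hc0.mul hW1).sub (hc1.mul hW0)
    have h2 : AnalyticOnNhd ℝ (fun _ : E3 => (0 : ℝ)) univ := analyticOnNhd_const
    have h12 : swirl W =ᶠ[𝓝 (0 : E3)] fun _ => (0 : ℝ) := by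
      filter_upwards [hball] with y hy
      exact hsw y (mem_ball_zero_iff.1 hy)
    exact h1.eqOn_of_preconnected_of_eventuallyEq h2 isPreconnected_univ (mem_univ 0) h12 (mem_univ y)

/-! ### (iii) The engine: local Euclidean symmetry ⇒ constancy, given F1, F2, G1 -/

/-- **Engine.**  Assume F2 (gradient bounds) and G1 (classical ⇒ mild).  A bounded classical steady Navier–Stokes flow `V` on `ℝ³`
with real-analytic velocity which, in some Euclidean frame `y ↦ x₀ + g y`, is rotation-invariant and swirl-free on a ball `‖y‖ < ρ`,
is CONSTANT: the conjugated flow is analytic, hence axisymmetric without swirl on `ℝ³`, is again a bounded classical steady flow,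
hence a bounded ancient mild solution, and KNSS 2009 Thm 5.2 applies.  (The analyticity is supplied by F1 in the two reductions
below; F2 and G1 — and the velocity analyticity of bounded steady flows — are in fact theorems of the tree, see
`ThreadingFluxCentreJetSteadyFacts.lean`, which feeds this engine without the fact hypotheses.) -/
theorem eq_const_of_local_symmetry
    (hF2 : ∀ (V : E3 → E3) (p : E3 → ℝ), IsSteadyNSOn univ V p → (∃ B : ℝ, ∀ x, ‖V x‖ ≤ B) →
      ∃ C : ℝ, ∀ x, ‖fderiv ℝ V x‖ ≤ C ∧ ‖gradient p x‖ ≤ C ∧ ‖Laplacian.laplacian V x‖ ≤ C)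
    (hG1 : ∀ (V : E3 → E3) (p : E3 → ℝ), IsSteadyNSOn univ V p → (∃ B : ℝ, ∀ x, ‖V x‖ ≤ B) →
      (∃ C : ℝ, ∀ x, ‖fderiv ℝ V x‖ ≤ C ∧ ‖gradient p x‖ ≤ C) →
      Literature.Analysis.FluidPDE.IsBoundedAncientMildSolution 1 (fun _ : ℝ => V))
    {V : E3 → E3} {p : E3 → ℝ} (hNS : IsSteadyNSOn univ V p) (hVan : AnalyticOnNhd ℝ V univ)
    (hB : ∃ B : ℝ, ∀ x, ‖V x‖ ≤ B) (x₀ : E3) {ρ : ℝ} (hρ : 0 < ρ) (g : E3 ≃ₗᵢ[ℝ] E3)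
    (hrot : ∀ θ : ℝ, ∀ y : E3, ‖y‖ < ρ → g.symm (V (x₀ + g (rotZ θ y))) = rotZ θ (g.symm (V (x₀ + g y))))
    (hsw : ∀ y : E3, ‖y‖ < ρ → swirl (fun z => g.symm (V (x₀ + g z))) y = 0) :
    ∃ b : E3, ∀ x, V x = b := by
  set W : E3 → E3 := fun y => g.symm (V (x₀ + g y)) with hW
  set q : E3 → ℝ := fun y => p (x₀ + g y) with hq
  have hWNS : IsSteadyNSOn univ W q := isSteadyNSOn_conjFrame hNS x₀ g
  -- analyticity of `W`
  have haff : AnalyticOnNhd ℝ (fun y : E3 => x₀ + g y) univ :=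
    analyticOnNhd_const.add ((g.toContinuousLinearEquiv.toContinuousLinearMap).analyticOnNhd univ)
  have hWan : AnalyticOnNhd ℝ W univ :=
    (g.symm.toContinuousLinearEquiv.toContinuousLinearMap).comp_analyticOnNhd (hVan.comp haff (mapsTo_univ _ _))
  -- the symmetry identities hold globally
  obtain ⟨haxi, hnosw⟩ := isAxisymmetric_hasNoSwirl_of_ball hWan hρ hrot hsw
  -- `W` is bounded, a bounded ancient mild solution
  obtain ⟨B, hBV⟩ := hB
  have hWB : ∃ B : ℝ, ∀ y, ‖W y‖ ≤ B := ⟨B, fun y => by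
    rw [hW, LinearIsometryEquiv.norm_map]; exact hBV _⟩
  obtain ⟨C, hC⟩ := hF2 W q hWNS hWB
  have hmild := hG1 W q hWNS hWB ⟨C, fun y => ⟨(hC y).1, (hC y).2.1⟩⟩
  -- KNSS 2009, Thm 5.2 (tree theorem): the slice `W` is a.e. constant
  have hWcont : Continuous W := continuousOn_univ.1 hWNS.1.continuousOn
  have hk := knss_axisymmetric_no_swirl'_holds (u := fun _ : ℝ => W) hmild
    (fun t _ => hWcont.aestronglyMeasurable) (fun t _ => haxi) (fun t _ => hnosw) (-1) (by norm_num)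
  obtain ⟨b, hb⟩ := hk
  have hWb : W = fun _ => b := (hWcont.ae_eq_iff_eq volume continuous_const).1 hb
  refine ⟨g b, fun x => ?_⟩
  have h1 : W (g.symm (x - x₀)) = g.symm (V x) := by
    simp [hW]
  have h2 : W (g.symm (x - x₀)) = b := by rw [hWb]
  calc V x = g (g.symm (V x)) := (g.apply_symm_apply (V x)).symm
    _ = g b := by rw [← h1, h2]

/-! ### (iv) The two reductions of the card, bodies verbatim -/

/-- ★ **(R2) `NoTypeNCentreOfRigidity`, body verbatim**: `SteadyNSAnalytic → SteadyNSGradientBounds → SteadyClassicalIsMild →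
SteadyLocalRigidityN → NoTypeNCentre`.  Given the literature-grade facts F1, F2, G1 and the (CONJECTURAL) type-N local rigidity C1, a
bounded classical steady Navier–Stokes flow on `ℝ³` unthreaded about `x₀` has `ΔV(x₀) = 0`: otherwise C1 makes it locally
axisymmetric without swirl in a frame at `x₀`, the engine makes it constant, and a constant field has `ΔV = 0`. -/
theorem noTypeNCentreOfRigidity :
    (∀ (U : Set E3) (V : E3 → E3) (p : E3 → ℝ), IsOpen U → IsSteadyNSOn U V p → AnalyticOnNhd ℝ V U ∧ AnalyticOnNhd ℝ p U) →
    (∀ (V : E3 → E3) (p : E3 → ℝ), IsSteadyNSOn univ V p → (∃ B : ℝ, ∀ x, ‖V x‖ ≤ B) →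
      ∃ C : ℝ, ∀ x, ‖fderiv ℝ V x‖ ≤ C ∧ ‖gradient p x‖ ≤ C ∧ ‖Laplacian.laplacian V x‖ ≤ C) →
    (∀ (V : E3 → E3) (p : E3 → ℝ), IsSteadyNSOn univ V p → (∃ B : ℝ, ∀ x, ‖V x‖ ≤ B) →
      (∃ C : ℝ, ∀ x, ‖fderiv ℝ V x‖ ≤ C ∧ ‖gradient p x‖ ≤ C) →
      Literature.Analysis.FluidPDE.IsBoundedAncientMildSolution 1 (fun _ : ℝ => V)) →
    (∀ (V : E3 → E3) (p : E3 → ℝ) (x₀ : E3) (ρ : ℝ), 0 < ρ →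
      AnalyticOnNhd ℝ V (Metric.ball x₀ ρ) → AnalyticOnNhd ℝ p (Metric.ball x₀ ρ) →
      IsSteadyNSOn (Metric.ball x₀ ρ) V p → (∀ x ∈ Metric.ball x₀ ρ, inner ℝ (x - x₀) (curl V x) = 0) →
      Laplacian.laplacian V x₀ ≠ 0 →
      ∃ g : E3 ≃ₗᵢ[ℝ] E3, (∃ a : ℝ, g (EuclideanSpace.single (2 : Fin 3) (1 : ℝ)) = a • Laplacian.laplacian V x₀) ∧
        (∀ θ : ℝ, ∀ y : E3, ‖y‖ < ρ → g.symm (V (x₀ + g (rotZ θ y))) = rotZ θ (g.symm (V (x₀ + g y)))) ∧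
        ∀ y : E3, ‖y‖ < ρ → swirl (fun z => g.symm (V (x₀ + g z))) y = 0) →
    ∀ (V : E3 → E3) (p : E3 → ℝ) (x₀ : E3), IsSteadyNSOn univ V p → (∃ B : ℝ, ∀ x, ‖V x‖ ≤ B) →
      IsUnthreadedAbout x₀ V → Laplacian.laplacian V x₀ = 0 := by
  intro hF1 hF2 hG1 hC1 V p x₀ hNS hB hun
  by_contra hΔ
  obtain ⟨hVan, hpan⟩ := hF1 univ V p isOpen_univ hNS
  obtain ⟨g, -, hrot, hsw⟩ := hC1 V p x₀ 1 one_pos (hVan.mono (subset_univ _)) (hpan.mono (subset_univ _))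
    (hNS.of_univ _) (fun x _ => hun x) hΔ
  obtain ⟨b, hb⟩ := eq_const_of_local_symmetry hF2 hG1 hNS hVan hB x₀ one_pos g hrot hsw
  have hV : V = fun _ => b := funext hb
  apply hΔ
  rw [hV]
  exact congrFun (InnerProductSpace.laplacian_const (E := E3) (c := b)) x₀

/-- ★ **(R2*) `SteadyStratumOfRigidity`, body verbatim**: `SteadyNSAnalytic → SteadyNSGradientBounds → SteadyClassicalIsMild →
SteadyLocalRigidity → IrrotationalSteadyLiouville → SteadyUnthreadedLiouville`.  Given F1, F2, G1, the (CONJECTURAL) master local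
rigidity C1* and R3, a bounded classical steady Navier–Stokes flow on `ℝ³` unthreaded about `x₀` is constant: if its vorticity
vanishes identically this is R3; otherwise C1* (on a ball about `x₀` containing a point of non-zero vorticity) makes it locally
axisymmetric without swirl in a frame at `x₀`, and the engine makes it constant. -/
theorem steadyStratumOfRigidity :
    (∀ (U : Set E3) (V : E3 → E3) (p : E3 → ℝ), IsOpen U → IsSteadyNSOn U V p → AnalyticOnNhd ℝ V U ∧ AnalyticOnNhd ℝ p U) →
    (∀ (V : E3 → E3) (p : E3 → ℝ), IsSteadyNSOn univ V p → (∃ B : ℝ, ∀ x, ‖V x‖ ≤ B) →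
      ∃ C : ℝ, ∀ x, ‖fderiv ℝ V x‖ ≤ C ∧ ‖gradient p x‖ ≤ C ∧ ‖Laplacian.laplacian V x‖ ≤ C) →
    (∀ (V : E3 → E3) (p : E3 → ℝ), IsSteadyNSOn univ V p → (∃ B : ℝ, ∀ x, ‖V x‖ ≤ B) →
      (∃ C : ℝ, ∀ x, ‖fderiv ℝ V x‖ ≤ C ∧ ‖gradient p x‖ ≤ C) →
      Literature.Analysis.FluidPDE.IsBoundedAncientMildSolution 1 (fun _ : ℝ => V)) →
    (∀ (V : E3 → E3) (p : E3 → ℝ) (x₀ : E3) (ρ : ℝ), 0 < ρ →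
      AnalyticOnNhd ℝ V (Metric.ball x₀ ρ) → AnalyticOnNhd ℝ p (Metric.ball x₀ ρ) →
      IsSteadyNSOn (Metric.ball x₀ ρ) V p → (∀ x ∈ Metric.ball x₀ ρ, inner ℝ (x - x₀) (curl V x) = 0) →
      (∃ x ∈ Metric.ball x₀ ρ, curl V x ≠ 0) →
      ∃ g : E3 ≃ₗᵢ[ℝ] E3,
        (∀ θ : ℝ, ∀ y : E3, ‖y‖ < ρ → g.symm (V (x₀ + g (rotZ θ y))) = rotZ θ (g.symm (V (x₀ + g y)))) ∧
        ∀ y : E3, ‖y‖ < ρ → swirl (fun z => g.symm (V (x₀ + g z))) y = 0) →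
    IrrotationalSteadyLiouville →
    ∀ (V : E3 → E3) (p : E3 → ℝ) (x₀ : E3), IsSteadyNSOn univ V p → (∃ B : ℝ, ∀ x, ‖V x‖ ≤ B) →
      IsUnthreadedAbout x₀ V → ∃ b : E3, ∀ x, V x = b := by
  intro hF1 hF2 hG1 hC1 hR3 V p x₀ hNS hB hun
  by_cases hirr : ∀ x, curl V x = 0
  · exact hR3 V p hNS hB hirr
  · push Not at hirr
    obtain ⟨x₁, hx₁⟩ := hirr
    set ρ : ℝ := dist x₁ x₀ + 1 with hρ
    have hρ0 : 0 < ρ := by positivity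
    have hx₁ρ : x₁ ∈ Metric.ball x₀ ρ := by
      rw [Metric.mem_ball, hρ]; linarith
    obtain ⟨hVan, hpan⟩ := hF1 univ V p isOpen_univ hNS
    obtain ⟨g, hrot, hsw⟩ := hC1 V p x₀ ρ hρ0 (hVan.mono (subset_univ _)) (hpan.mono (subset_univ _))
      (hNS.of_univ _) (fun x _ => hun x) ⟨x₁, hx₁ρ, hx₁⟩
    exact eq_const_of_local_symmetry hF2 hG1 hNS hVan hB x₀ hρ0 g hrot hsw

end Summit.NavierStokesRegularity.NavierStokesRegularity.Theorems.PoloidalLiouville.CentreJet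

end
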